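import Mathlib
import Literature.NumberTheory.LFunctions.Zhang2022.Section15U009Shift
import Literature.NumberTheory.LFunctions.Zhang2022.Section15U009Core
import Literature.NumberTheory.LFunctions.Zhang2022.Section14Eq143Assembly
import HarnessLib

/-!
# Zhang (2022) §15 u009 (p. 80, tex L4037) — `Z22:§15.u009` DISCHARGED: the extension `Ψ₁ → Ψ` on
# `𝔍(−1)` (`u009_extend_eventually`) and `Typed.Section15A.step15_u009_holds`

Topic `Literature/NumberTheory/LFunctions/Zhang2022` (Landau–Siegel audit tree; verdict-neutral).
Y. Zhang, *Discrete mean estimates and the Landau–Siegel zero*, arXiv:2211.02515v1 (2022)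
[Zhang2022LandauSiegel] — **an unrefereed manuscript under adjudication; nothing here asserts or
denies its Theorems 1–2.** ZHANG-L discharge lane (helper under leaf `Typed.Section15A.Eq15_6`, via
the tree edge `eq15_4_of : Step15_u008 → Step15_u009 → Step15_u012 → Eq15_4`); THEOREM-ONLY.

§15 p. 80 (tex L4037), inside the proof of (15.4):

> In a way similar to the proof of (7.3), the sum over `ψ ∈ Ψ₁` can be extended to the sum over
> `ψ ∈ Ψ`, and then the segment `𝔍(−1)` can be replaced by the line `σ = −1/2`, with acceptable errors.

* `U009.u009_extend_eventually` — the FIRST half (the statement `Typed.Section15A.Step15_u009a` of the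
  typer's sub-step file, abbreviation unfolded): `τ(χ)Σ_{ψ∈Ψ₁}χ(p)(pt₀)^{−β₃}(1/2πi)∫_{𝔍(−1)}KBω =
  τ(χ)Σ_{ψ∈Ψ}(…) + o(𝔓)`. Assembled EXACTLY as the tree's (14.3) (`Typed.Sec14.Eq143.dedEq143_of_tail`),
  in mirror image: the difference is `−τ(χ)Σ_{Ψ₂}(…)`; per `ψ` the `𝔍(−1)`-integrand splits into head
  and tail (`ktildeSeries_eq_head_add_tail`, `Re s = −1/2 < 0`); the head is `≤ ∫_{𝔍(0)}|…||ds| +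
  O(e^{−𝓛¹⁰/16})` (`U009.shift`), the tail `O(e^{−𝓛¹⁰/16})` (`U009.tail`); on `𝔍(0)`,
  `|D^{−(1−s)}| = D^{−1/2}` and `Σ_{Ψ₂}|head||B| ≤ K𝔓𝓛⁻¹⁹` (`U009.core` with `Skeleton.prop21_holds`,
  `Skeleton.lemma33b_holds`), `∫_{𝔍(0)}|ω||ds| ≤ C₇₄` ((7.4)); `|τ(χ)| = √D` cancels `D^{−1/2}`, and
  `#Ψ₂ ≤ 𝔓`, `√D·e^{−𝓛¹⁰/16} ≤ e^{−𝓛/16}`.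
* `Typed.Section15A.step15_u009_holds : ∀ c′, Step15_u009 c′` — **`Z22:§15.u009` DISCHARGED**, from the
  first half and the second half `U009.u009_line_eventually` (`Section15U009Line`), `ε/2 + ε/2`.
  Assumption (A) enters only through Proposition 2.1.

## References

* Y. Zhang, arXiv:2211.02515v1 (2022), §15 p. 80, tex L4033–L4041; §7 (7.3)–(7.5) pp. 34–35.
  [cite: Zhang2022LandauSiegel, §15 p. 80]
-/

noncomputable section

open Complex Real MeasureTheory Set intervalIntegral
open scoped ComplexConjugate

namespace Literature.NumberTheory.LFunctions.Zhang2022.Typed.Section15A.U009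

open Skeleton Section7aStatements Section7Eq73Edge Typed.Sec14.Eq143

variable (c' : ℝ) {D : ℕ}

/-- `2πt₀ − 𝓛₁ > 0` for `𝓛 ≥ 1`. [folklore] -/
private theorem twoPiT0_sub_ell1_pos'' {D : ℕ} (hℓ : 1 ≤ ell D) : 0 < 2 * π * t0 D - ell1 D := by
  have h1 : ell D ^ 405 ≤ ell D ^ 519 := pow_le_pow_right₀ hℓ (by norm_num)
  have h2 : 1 ≤ ell D ^ 519 := one_le_pow₀ hℓ
  rw [t0, ell1]; nlinarith [Real.pi_gt_three]

/-- `finsetOf univ = univ` for the finite type `Ψ`. [folklore] -/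
private theorem finsetOf_univ_eq {D : ℕ} [Fintype (Chr D)] :
    finsetOf (Set.univ : Set (Chr D)) = Finset.univ := by
  ext x
  simp [mem_finsetOf Set.finite_univ]

/-- `√D·e^{−𝓛¹⁰/16} ≤ e^{−𝓛/16}` for `𝓛 ≥ 2` (`√D = e^{𝓛/2}`, `𝓛¹⁰ ≥ 9𝓛`). [folklore] -/
private theorem sqrt_mul_exp_le {D : ℕ} (hD1 : 1 ≤ D) (hℓ : 2 ≤ ell D) :
    Real.sqrt D * Real.exp (-(1 / 16) * ell D ^ 10) ≤ Real.exp (-(ell D / 16)) := by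
  have hD0 : (0 : ℝ) < D := by exact_mod_cast hD1
  have hsqrt : Real.sqrt D = Real.exp (ell D / 2) := by
    have h : (D : ℝ) = Real.exp (ell D / 2) ^ 2 := by
      rw [← Real.exp_nat_mul, show ((2 : ℕ) : ℝ) * (ell D / 2) = ell D by push_cast; ring, ell,
        Real.exp_log hD0]
    rw [h, Real.sqrt_sq (Real.exp_pos _).le]
  rw [hsqrt, ← Real.exp_add]
  apply Real.exp_le_exp.mpr
  have hℓ1 : 1 ≤ ell D := by linarith
  have h9 : (9 : ℝ) ≤ ell D ^ 9 := by
    calc (9 : ℝ) ≤ 2 ^ 9 := by norm_num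
      _ ≤ ell D ^ 9 := pow_le_pow_left₀ (by norm_num) hℓ 9
  have h10 : ell D ^ 10 = ell D * ell D ^ 9 := by ring
  rw [h10]; nlinarith

/-! ## u009, first half: the extension `Ψ₁ → Ψ` -/

set_option maxHeartbeats 400000 in
/-- **`Z22:§15.u009`, first half, HOLDS** (§15 p. 80, tex L4037: "In a way similar to the proof of (7.3),
the sum over `ψ ∈ Ψ₁` can be extended to the sum over `ψ ∈ Ψ`"): for every `ε > 0`, all large `D`,
all real primitive `χ (mod D)` under (A),
`‖τ(χ)Σ_{ψ∈Ψ₁}χ(p)(pt₀)^{−β₃}(1/2πi)∫_{𝔍(−1)}KBω − τ(χ)Σ_{ψ∈Ψ}χ(p)(pt₀)^{−β₃}(1/2πi)∫_{𝔍(−1)}KBω‖ ≤ ε𝔓`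
— the statement `Typed.Section15A.Step15_u009a c′` of the typer's sub-step file with `termSegU009`
unfolded. [cite: Zhang2022LandauSiegel, §15 p. 80, tex L4037] -/
theorem u009_extend_eventually (c' : ℝ) : ∀ ε : ℝ, 0 < ε → ForAllLarge fun D _ χ => AssumptionA D χ →
    ‖GammaFactor.tau χ * (∑ x ∈ finsetOf (PsiOne χ),
          χ (x.p : ZMod D) * (((x.p : ℝ) * t0 D : ℝ) : ℂ) ^ (-beta3 c' D) *
            Lemma81.segInt (t0 D) (ell1 D) (-1) (fun s =>
              ktildeSeries c' x s * Bpoly χ x s * omegaW D s)) -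
        GammaFactor.tau χ * ∑ᶠ x : Chr D,
          χ (x.p : ZMod D) * (((x.p : ℝ) * t0 D : ℝ) : ℂ) ^ (-beta3 c' D) *
            Lemma81.segInt (t0 D) (ell1 D) (-1) (fun s =>
              ktildeSeries c' x s * Bpoly χ x s * omegaW D s)‖
      ≤ ε * frakP D := by
  intro ε hε
  obtain ⟨K, D₁, Hcore⟩ := core prop21_holds lemma33b_holds c'
  obtain ⟨C₇₄, D₂, H74⟩ := eq74_holds
  obtain ⟨Cs, D₃, Hs⟩ := shift c'
  obtain ⟨Ct, D₄, Ht⟩ := tail c'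
  set K' : ℝ := max K 0 with hK'
  set C' : ℝ := max C₇₄ 0 with hC'
  set M : ℝ := max 2 (max (2 * K' * C' / ε) (32 * (|Cs| + |Ct|) / ε)) with hMdef
  obtain ⟨D₅, H5⟩ := exists_nat_forall_le_ell M
  refine ⟨max (max (max D₁ D₂) (max D₃ D₄)) (max D₅ 3), fun D _ χ hD hq hp hA => ?_⟩
  have hD12 : max D₁ D₂ ≤ D := le_trans (le_trans (le_max_left _ _) (le_max_left _ _)) hD
  have hD34 : max D₃ D₄ ≤ D := le_trans (le_trans (le_max_right _ _) (le_max_left _ _)) hD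
  have hD1 : D₁ ≤ D := le_trans (le_max_left _ _) hD12
  have hD2 : D₂ ≤ D := le_trans (le_max_right _ _) hD12
  have hD3 : D₃ ≤ D := le_trans (le_max_left _ _) hD34
  have hD4 : D₄ ≤ D := le_trans (le_max_right _ _) hD34
  have hD5 : D₅ ≤ D := le_trans (le_trans (le_max_left _ _) (le_max_right _ _)) hD
  have hD3' : 3 ≤ D := le_trans (le_trans (le_max_right _ _) (le_max_right _ _)) hD
  have hD1' : 1 ≤ D := le_trans (by norm_num) hD3'
  have hD0 : 0 < D := by omega
  have hM := H5 D hD5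
  have hℓ2 : 2 ≤ ell D := le_trans (le_max_left _ _) hM
  have hℓ1 : 1 ≤ ell D := by linarith
  have hℓ0 : 0 < ell D := by linarith
  have hL0 : 0 ≤ ell1 D := by rw [ell1]; positivity
  have hside : 0 < 2 * π * t0 D - ell1 D := twoPiT0_sub_ell1_pos'' hℓ1
  have ht0 : 0 < t0 D := by rw [t0]; positivity
  classical
  haveI : Fintype (Chr D) := Fintype.ofFinite (Chr D)
  -- notation
  set X : ℕ := ⌊bigP D ^ 2⌋₊ with hX
  set S := finsetOf (PsiTwo χ) with hSdef
  set e : ℝ := Real.exp (-(1 / 16) * ell D ^ 10) with hedef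
  have he : 0 < e := Real.exp_pos _
  have hfrakP : 0 ≤ frakP D := le_trans (Nat.cast_nonneg _) (card_finsetOf_PsiTwo_le_frakP χ)
  -- the weights and the three integrands, per character
  set wt : Chr D → ℂ := fun x => χ (x.p : ZMod D) * (((x.p : ℝ) * t0 D : ℝ) : ℂ) ^ (-beta3 c' D)
    with hwt
  set Hf : Chr D → ℂ → ℂ := fun x w =>
    ∑ m ∈ Finset.Icc 1 X, ktilde c' D m * conj (x.ψ (m : ZMod x.p)) * (m : ℂ) ^ (-w) with hHf
  set Lf : Chr D → ℂ → ℂ := fun x w =>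
    LSeries (fun m : ℕ => if X < m then ktilde c' D m * conj (x.ψ (m : ZMod x.p)) else 0) w with hLf
  set Ffull : Chr D → ℂ → ℂ := fun x s => ktildeSeries c' x s * Bpoly χ x s * omegaW D s with hFfull
  set Ffin : Chr D → ℂ → ℂ := fun x s => conj (x.ψ (D : ZMod x.p)) * (D : ℂ) ^ (-(1 - s)) *
    Hf x (1 - s) * Bpoly χ x s * omegaW D s with hFfin
  set Ftail : Chr D → ℂ → ℂ := fun x s => conj (x.ψ (D : ZMod x.p)) * (D : ℂ) ^ (-(1 - s)) *
    Lf x (1 - s) * Bpoly χ x s * omegaW D s with hFtail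
  have hwt1 : ∀ x : Chr D, ‖wt x‖ ≤ 1 := by
    intro x
    rw [hwt, norm_mul, norm_pt0_cpow_neg_beta3 c' x ht0, mul_one]
    exact DirichletCharacter.norm_le_one _ _
  -- Step 1: `τ(Σ_{Ψ₁} − Σ_Ψ) = −τ Σ_{Ψ₂}`
  have hz : ((-1 : ℝ) : ℂ) = -1 := by push_cast; ring
  have hI : ∀ x : Chr D, Lemma81.segInt (t0 D) (ell1 D) (-1) (Ffull x) =
      Lemma81.segInt (t0 D) (ell1 D) ((-1 : ℝ) : ℂ) (Ffull x) := by intro x; rw [hz]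
  have hdiff : GammaFactor.tau χ * (∑ x ∈ finsetOf (PsiOne χ),
        wt x * Lemma81.segInt (t0 D) (ell1 D) (-1) (Ffull x)) -
      GammaFactor.tau χ * ∑ᶠ x : Chr D, wt x * Lemma81.segInt (t0 D) (ell1 D) (-1) (Ffull x) =
      -(GammaFactor.tau χ * ∑ x ∈ S, wt x * Lemma81.segInt (t0 D) (ell1 D) ((-1 : ℝ) : ℂ) (Ffull x)) := by
    rw [finsum_eq_sum_of_fintype, ← finsetOf_univ_eq, sum_finsetOf_univ_eq χ]
    simp only [hI]
    ring
  -- Step 2: on `𝔍(−1)` the series splits, and so does the integral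
  have hpt_re : ∀ v : ℝ, (((-1 : ℝ) : ℂ) + s0 D + v * I).re = -1 / 2 := by
    intro v; simp [s0, SmoothWeight.s0]; norm_num
  have hsplit_pt : ∀ (x : Chr D) (v : ℝ),
      Ffull x (((-1 : ℝ) : ℂ) + s0 D + v * I) =
        Ffin x (((-1 : ℝ) : ℂ) + s0 D + v * I) + Ftail x (((-1 : ℝ) : ℂ) + s0 D + v * I) := by
    intro x v
    have hs : (((-1 : ℝ) : ℂ) + s0 D + v * I).re < 0 := by rw [hpt_re]; norm_num
    simp only [hFfull, hFfin, hFtail, hHf, hLf]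
    rw [ktildeSeries_eq_head_add_tail c' x hℓ0 X hs]; ring
  -- differentiability of the two pieces
  have hFinD : ∀ x : Chr D, Differentiable ℂ (Ffin x) := by
    intro x
    have h1 : Differentiable ℂ (fun s : ℂ => (D : ℂ) ^ (-(1 - s))) := fun s =>
      DifferentiableAt.const_cpow (by fun_prop) (Or.inl (Nat.cast_ne_zero.mpr hD0.ne'))
    have h2 : Differentiable ℂ (fun s : ℂ => Hf x (1 - s)) :=
      (differentiable_ktilde_head c' x X).comp ((differentiable_const _).sub differentiable_id)
    exact ((((differentiable_const _).mul h1).mul h2).mul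
      (Typed.Section17.differentiable_Bpoly χ x)).mul (differentiable_omegaW D)
  have hopen : IsOpen {w : ℂ | 1 < w.re} := isOpen_lt continuous_const Complex.continuous_re
  have hFtailAt : ∀ (x : Chr D) (s : ℂ), s.re < 0 → DifferentiableAt ℂ (Ftail x) s := by
    intro x s hre
    have hw : (1 - s) ∈ {w : ℂ | 1 < w.re} := by
      simp only [Set.mem_setOf_eq, sub_re, one_re]; linarith
    have h1 : DifferentiableAt ℂ (fun s : ℂ => (D : ℂ) ^ (-(1 - s))) s :=
      DifferentiableAt.const_cpow (by fun_prop) (Or.inl (Nat.cast_ne_zero.mpr hD0.ne'))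
    have h2 : DifferentiableAt ℂ (fun s : ℂ => Lf x (1 - s)) s :=
      ((differentiableOn_LSeries_ktilde_tail c' x hℓ0 X).differentiableAt (hopen.mem_nhds hw)).comp s
        ((differentiableAt_const _).sub differentiableAt_id)
    exact ((((differentiableAt_const _).mul h1).mul h2).mul
      ((Typed.Section17.differentiable_Bpoly χ x) s)).mul ((differentiable_omegaW D) s)
  have hptc := continuous_segPoint (D := D) (-1)
  have hint_fin : ∀ x : Chr D, IntervalIntegrable
      (fun v : ℝ => Ffin x (((-1 : ℝ) : ℂ) + s0 D + v * I)) volume (-ell1 D) (ell1 D) := fun x =>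
    ((hFinD x).continuous.comp hptc).intervalIntegrable _ _
  have hint_tail : ∀ x : Chr D, IntervalIntegrable
      (fun v : ℝ => Ftail x (((-1 : ℝ) : ℂ) + s0 D + v * I)) volume (-ell1 D) (ell1 D) := by
    intro x
    refine ContinuousOn.intervalIntegrable fun v _ => ?_
    have h1 : DifferentiableAt ℂ (Ftail x) (((-1 : ℝ) : ℂ) + s0 D + v * I) :=
      hFtailAt x _ (by rw [hpt_re]; norm_num)
    exact (ContinuousAt.comp (f := fun v : ℝ => ((-1 : ℝ) : ℂ) + s0 D + v * I)
      h1.continuousAt hptc.continuousAt).continuousWithinAt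
  have hsplit : ∀ x : Chr D, intJ D (-1) (Ffull x) = intJ D (-1) (Ffin x) + intJ D (-1) (Ftail x) := by
    intro x
    have e1 : (∫ v in (-ell1 D)..ell1 D, Ffull x (((-1 : ℝ) : ℂ) + s0 D + v * I)) =
        ∫ v in (-ell1 D)..ell1 D, (Ffin x (((-1 : ℝ) : ℂ) + s0 D + v * I) +
          Ftail x (((-1 : ℝ) : ℂ) + s0 D + v * I)) :=
      intervalIntegral.integral_congr fun v _ => hsplit_pt x v
    show 2 * π * I * ((1 / (2 * π) : ℂ) * ∫ v in (-ell1 D)..ell1 D,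
        Ffull x (((-1 : ℝ) : ℂ) + s0 D + v * I)) =
      2 * π * I * ((1 / (2 * π) : ℂ) * ∫ v in (-ell1 D)..ell1 D,
        Ffin x (((-1 : ℝ) : ℂ) + s0 D + v * I)) +
      2 * π * I * ((1 / (2 * π) : ℂ) * ∫ v in (-ell1 D)..ell1 D,
        Ftail x (((-1 : ℝ) : ℂ) + s0 D + v * I))
    rw [e1, intervalIntegral.integral_add (hint_fin x) (hint_tail x)]
    ring
  -- Step 3: the per-character bounds
  have hfinx : ∀ x : Chr D, ‖intJ D (-1) (Ffin x)‖ ≤ absIntJ D 0 (Ffin x) + Cs * e :=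
    fun x => Hs D χ hD3 hq hp x
  have htailx : ∀ x : Chr D, ‖intJ D (-1) (Ftail x)‖ ≤ Ct * e :=
    fun x => Ht D χ hD4 hq hp x
  have hperx : ∀ x : Chr D, ‖wt x * Lemma81.segInt (t0 D) (ell1 D) ((-1 : ℝ) : ℂ) (Ffull x)‖ ≤
      absIntJ D 0 (Ffin x) + (Cs + Ct) * e := by
    intro x
    rw [norm_mul]
    calc ‖wt x‖ * ‖Lemma81.segInt (t0 D) (ell1 D) ((-1 : ℝ) : ℂ) (Ffull x)‖
        ≤ 1 * ‖intJ D (-1) (Ffull x)‖ :=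
          mul_le_mul (hwt1 x) (norm_segInt_le_norm_intJ D (-1) (Ffull x)) (norm_nonneg _) zero_le_one
      _ = ‖intJ D (-1) (Ffin x) + intJ D (-1) (Ftail x)‖ := by rw [one_mul, hsplit]
      _ ≤ ‖intJ D (-1) (Ffin x)‖ + ‖intJ D (-1) (Ftail x)‖ := norm_add_le _ _
      _ ≤ absIntJ D 0 (Ffin x) + Cs * e + Ct * e := add_le_add (hfinx x) (htailx x)
      _ = _ := by ring
  -- Step 4: the sum over `Ψ₂` of the `𝔍(0)`-integrals
  have hω : Continuous fun v : ℝ => ‖omegaW D (((0 : ℝ) : ℂ) + s0 D + v * I)‖ :=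
    (continuous_omegaW_seg (D := D) 0).norm
  have hpt0 := continuous_segPoint (D := D) 0
  have hG : ∀ x : Chr D, Continuous fun v : ℝ => ‖Ffin x (((0 : ℝ) : ℂ) + s0 D + v * I)‖ :=
    fun x => ((hFinD x).continuous.comp hpt0).norm
  have hℓℓ : -ell1 D ≤ ell1 D := by linarith
  have hDhalf : ∀ v : ℝ, ‖(D : ℂ) ^ (-(1 - (((0 : ℝ) : ℂ) + s0 D + v * I)))‖ = (D : ℝ) ^ (-(1 / 2 : ℝ)) := by
    intro v
    rw [Complex.norm_natCast_cpow_of_pos hD0, neg_re, sub_re, one_re, segPoint_zero_re]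
    norm_num
  have hD12 : 0 ≤ (D : ℝ) ^ (-(1 / 2 : ℝ)) := Real.rpow_nonneg (Nat.cast_nonneg D) _
  have hmain : ∑ x ∈ S, absIntJ D 0 (Ffin x) ≤
      (D : ℝ) ^ (-(1 / 2 : ℝ)) * (K' * frakP D * (ell D ^ 19)⁻¹) * C' := by
    have hswap : ∑ x ∈ S, absIntJ D 0 (Ffin x) =
        ∫ v in (-ell1 D)..ell1 D, ∑ x ∈ S, ‖Ffin x (((0 : ℝ) : ℂ) + s0 D + v * I)‖ := by
      rw [intervalIntegral.integral_finsetSum fun x _ => (hG x).intervalIntegrable _ _]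
      rfl
    rw [hswap]
    have hpt : ∀ v : ℝ, ∑ x ∈ S, ‖Ffin x (((0 : ℝ) : ℂ) + s0 D + v * I)‖ ≤
        (D : ℝ) ^ (-(1 / 2 : ℝ)) * (K' * frakP D * (ell D ^ 19)⁻¹) *
          ‖omegaW D (((0 : ℝ) : ℂ) + s0 D + v * I)‖ := by
      intro v
      set sv : ℂ := ((0 : ℝ) : ℂ) + s0 D + v * I with hsv
      have h := Hcore D χ hD1 hq hp hA sv (segPoint_zero_re (D := D) v)
      have e1 : ∑ x ∈ S, ‖Ffin x sv‖ ≤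
          (D : ℝ) ^ (-(1 / 2 : ℝ)) * (∑ x ∈ S, ‖Hf x (1 - sv)‖ * ‖Bpoly χ x sv‖) * ‖omegaW D sv‖ := by
        rw [Finset.mul_sum, Finset.sum_mul]
        refine Finset.sum_le_sum fun x _ => ?_
        have hψ : ‖conj (x.ψ (D : ZMod x.p))‖ ≤ 1 := by
          rw [Complex.norm_conj]; exact DirichletCharacter.norm_le_one _ _
        have hDsv : ‖(D : ℂ) ^ (-(1 - sv))‖ = (D : ℝ) ^ (-(1 / 2 : ℝ)) := by rw [hsv]; exact hDhalf v
        simp only [hFfin, norm_mul, hDsv]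
        have h0 : 0 ≤ (D : ℝ) ^ (-(1 / 2 : ℝ)) * ‖Hf x (1 - sv)‖ * ‖Bpoly χ x sv‖ * ‖omegaW D sv‖ := by
          positivity
        calc ‖conj (x.ψ (D : ZMod x.p))‖ * (D : ℝ) ^ (-(1 / 2 : ℝ)) * ‖Hf x (1 - sv)‖ *
              ‖Bpoly χ x sv‖ * ‖omegaW D sv‖
            ≤ 1 * (D : ℝ) ^ (-(1 / 2 : ℝ)) * ‖Hf x (1 - sv)‖ * ‖Bpoly χ x sv‖ * ‖omegaW D sv‖ := by
              have := mul_le_mul_of_nonneg_right hψ h0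
              calc _ = ‖conj (x.ψ (D : ZMod x.p))‖ * ((D : ℝ) ^ (-(1 / 2 : ℝ)) * ‖Hf x (1 - sv)‖ *
                    ‖Bpoly χ x sv‖ * ‖omegaW D sv‖) := by ring
                _ ≤ 1 * ((D : ℝ) ^ (-(1 / 2 : ℝ)) * ‖Hf x (1 - sv)‖ * ‖Bpoly χ x sv‖ * ‖omegaW D sv‖) := this
                _ = _ := by ring
          _ = (D : ℝ) ^ (-(1 / 2 : ℝ)) * (‖Hf x (1 - sv)‖ * ‖Bpoly χ x sv‖) * ‖omegaW D sv‖ := by ring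
      refine e1.trans (mul_le_mul_of_nonneg_right (mul_le_mul_of_nonneg_left (h.trans ?_) hD12)
        (norm_nonneg _))
      have hK : K ≤ K' := le_max_left _ _
      have h19 : 0 ≤ (ell D ^ 19)⁻¹ := by positivity
      nlinarith [mul_nonneg hfrakP h19]
    have hcst0 : 0 ≤ (D : ℝ) ^ (-(1 / 2 : ℝ)) * (K' * frakP D * (ell D ^ 19)⁻¹) :=
      mul_nonneg hD12 (mul_nonneg (mul_nonneg (le_max_right _ _) hfrakP) (by positivity))
    calc ∫ v in (-ell1 D)..ell1 D, ∑ x ∈ S, ‖Ffin x (((0 : ℝ) : ℂ) + s0 D + v * I)‖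
        ≤ ∫ v in (-ell1 D)..ell1 D, (D : ℝ) ^ (-(1 / 2 : ℝ)) * (K' * frakP D * (ell D ^ 19)⁻¹) *
            ‖omegaW D (((0 : ℝ) : ℂ) + s0 D + v * I)‖ :=
          intervalIntegral.integral_mono_on hℓℓ
            ((continuous_finsetSum _ fun x _ => hG x).intervalIntegrable _ _)
            ((continuous_const.mul hω).intervalIntegrable _ _) (fun v _ => hpt v)
      _ = (D : ℝ) ^ (-(1 / 2 : ℝ)) * (K' * frakP D * (ell D ^ 19)⁻¹) * absIntJ D 0 (omegaW D) := by
          rw [intervalIntegral.integral_const_mul]; rfl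
      _ ≤ (D : ℝ) ^ (-(1 / 2 : ℝ)) * (K' * frakP D * (ell D ^ 19)⁻¹) * C' :=
          mul_le_mul_of_nonneg_left ((H74 D χ hD2 hq hp 0 (by
            rw [abs_zero]; positivity)).trans (le_max_left _ _)) hcst0
  -- Step 5: the accumulated per-character errors, `#Ψ₂ ≤ 𝔓`
  have hcount : (S.card : ℝ) * ((Cs + Ct) * e) ≤ frakP D * ((|Cs| + |Ct|) * e) :=
    calc (S.card : ℝ) * ((Cs + Ct) * e) ≤ (S.card : ℝ) * ((|Cs| + |Ct|) * e) :=
          mul_le_mul_of_nonneg_left (mul_le_mul_of_nonneg_right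
            (add_le_add (le_abs_self _) (le_abs_self _)) he.le) (Nat.cast_nonneg _)
      _ ≤ frakP D * ((|Cs| + |Ct|) * e) :=
          mul_le_mul_of_nonneg_right (card_finsetOf_PsiTwo_le_frakP χ) (by positivity)
  -- Step 6: `|τ(χ)| = √D`, `√D·D^{−1/2} = 1`, `√D·e ≤ e^{−𝓛/16}`
  have hτ : ‖GammaFactor.tau χ‖ = Real.sqrt D := norm_tau_eq_sqrt hp
  have hDpos : (0 : ℝ) < D := by exact_mod_cast hD0
  have hsqD : Real.sqrt D * (D : ℝ) ^ (-(1 / 2 : ℝ)) = 1 := by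
    rw [Real.sqrt_eq_rpow, ← Real.rpow_add hDpos]; norm_num
  have hsqe : Real.sqrt D * e ≤ Real.exp (-(ell D / 16)) := sqrt_mul_exp_le hD1' hℓ2
  -- Step 7: smallness for `𝓛 ≥ M`
  have hsmall1 : K' * (ell D ^ 19)⁻¹ * C' ≤ ε / 2 := by
    have hKC : 0 ≤ K' * C' := mul_nonneg (le_max_right _ _) (le_max_right _ _)
    have h1 : 2 * K' * C' / ε ≤ ell D := le_trans (le_trans (le_max_left _ _) (le_max_right _ _)) hM
    have h2 : 2 * K' * C' ≤ ε * ell D := by rw [div_le_iff₀ hε] at h1; linarith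
    have h5 : ell D ≤ ell D ^ 19 := le_self_pow₀ hℓ1 (by norm_num)
    have h5' : 0 < ell D ^ 19 := by positivity
    rw [show K' * (ell D ^ 19)⁻¹ * C' = K' * C' / ell D ^ 19 by ring, div_le_iff₀ h5']
    nlinarith
  have hsmall2 : (|Cs| + |Ct|) * Real.exp (-(ell D / 16)) ≤ ε / 2 := by
    have hA0 : 0 ≤ |Cs| + |Ct| := by positivity
    have h1 : 32 * (|Cs| + |Ct|) / ε ≤ ell D :=
      le_trans (le_trans (le_max_right _ _) (le_max_right _ _)) hM
    have h2 : 32 * (|Cs| + |Ct|) ≤ ε * ell D := by rw [div_le_iff₀ hε] at h1; linarith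
    have he2 : Real.exp (-(ell D / 16)) ≤ 16 / ell D := by
      have h := Real.add_one_le_exp (ell D / 16)
      rw [Real.exp_neg, inv_eq_one_div, div_le_div_iff₀ (Real.exp_pos _) hℓ0]
      nlinarith
    calc (|Cs| + |Ct|) * Real.exp (-(ell D / 16)) ≤ (|Cs| + |Ct|) * (16 / ell D) :=
          mul_le_mul_of_nonneg_left he2 hA0
      _ = 16 * (|Cs| + |Ct|) / ell D := by ring
      _ ≤ ε / 2 := by rw [div_le_iff₀ hℓ0]; nlinarith
  -- assemble
  rw [hdiff, norm_neg, norm_mul, hτ]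
  have hsum_le : ‖∑ x ∈ S, wt x * Lemma81.segInt (t0 D) (ell1 D) ((-1 : ℝ) : ℂ) (Ffull x)‖ ≤
      (D : ℝ) ^ (-(1 / 2 : ℝ)) * (K' * frakP D * (ell D ^ 19)⁻¹) * C' + frakP D * ((|Cs| + |Ct|) * e) :=
    calc ‖∑ x ∈ S, wt x * Lemma81.segInt (t0 D) (ell1 D) ((-1 : ℝ) : ℂ) (Ffull x)‖
        ≤ ∑ x ∈ S, ‖wt x * Lemma81.segInt (t0 D) (ell1 D) ((-1 : ℝ) : ℂ) (Ffull x)‖ := norm_sum_le _ _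
      _ ≤ ∑ x ∈ S, (absIntJ D 0 (Ffin x) + (Cs + Ct) * e) := Finset.sum_le_sum fun x _ => hperx x
      _ = ∑ x ∈ S, absIntJ D 0 (Ffin x) + (S.card : ℝ) * ((Cs + Ct) * e) := by
          rw [Finset.sum_add_distrib, Finset.sum_const, nsmul_eq_mul]
      _ ≤ _ := add_le_add hmain hcount
  calc Real.sqrt D * ‖∑ x ∈ S, wt x * Lemma81.segInt (t0 D) (ell1 D) ((-1 : ℝ) : ℂ) (Ffull x)‖
      ≤ Real.sqrt D * ((D : ℝ) ^ (-(1 / 2 : ℝ)) * (K' * frakP D * (ell D ^ 19)⁻¹) * C' +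
          frakP D * ((|Cs| + |Ct|) * e)) := mul_le_mul_of_nonneg_left hsum_le (Real.sqrt_nonneg _)
    _ = (Real.sqrt D * (D : ℝ) ^ (-(1 / 2 : ℝ))) * (frakP D * (K' * (ell D ^ 19)⁻¹ * C')) +
          frakP D * ((|Cs| + |Ct|) * (Real.sqrt D * e)) := by ring
    _ ≤ 1 * (frakP D * (ε / 2)) + frakP D * ((|Cs| + |Ct|) * Real.exp (-(ell D / 16))) := by
        rw [hsqD]
        have hA0 : 0 ≤ |Cs| + |Ct| := by positivity
        exact add_le_add (mul_le_mul_of_nonneg_left (mul_le_mul_of_nonneg_left hsmall1 hfrakP) zero_le_one)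
          (mul_le_mul_of_nonneg_left (mul_le_mul_of_nonneg_left hsqe hA0) hfrakP)
    _ ≤ 1 * (frakP D * (ε / 2)) + frakP D * (ε / 2) :=
        add_le_add le_rfl (mul_le_mul_of_nonneg_left hsmall2 hfrakP)
    _ = ε * frakP D := by ring

/-! ## `Z22:§15.u009` -/

/-- **`Z22:§15.u009` DISCHARGED** (§15 p. 80, tex L4037): `Typed.Section15A.Step15_u009 c′` holds for
every `c′` — `τ(χ)Σ_{ψ∈Ψ₁}χ(p)(pt₀)^{−β₃}(1/2πi)∫_{𝔍(−1)}(Σ_m k̃(m)ψ̄(Dm)(Dm)^{s−1})B(s,ψ)ω(s)ds`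
equals `τ(χ)Σ_{p∼P}χ(p)(pt₀)^{−β₃}Σ*_{ψ (mod p)}(1/2πi)∫_{(−1/2)}(…)ds + o(𝔓)`: the extension
`Ψ₁ → Ψ` (`u009_extend_eventually`) and the replacement of `𝔍(−1)` by the line
(`u009_line_eventually`), `ε/2 + ε/2`. This is the middle input of the tree's edge
`eq15_4_of : Step15_u008 → Step15_u009 → Step15_u012 → Eq15_4` under the leaf `Eq15_6`.
[cite: Zhang2022LandauSiegel, §15 p. 80, tex L4037] -/
theorem _root_.Literature.NumberTheory.LFunctions.Zhang2022.Typed.Section15A.step15_u009_holds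
    (c' : ℝ) : Step15_u009 c' := by
  intro ε hε
  have hε2 : 0 < ε / 2 := by positivity
  obtain ⟨D₁, h₁⟩ := u009_extend_eventually c' (ε / 2) hε2
  obtain ⟨D₂, h₂⟩ := u009_line_eventually c' (ε / 2) hε2
  refine ⟨max D₁ D₂, fun D _ χ hD hq hp hA => ?_⟩
  have e₁ := h₁ D χ (le_trans (le_max_left _ _) hD) hq hp hA
  have e₂ := h₂ D χ (le_trans (le_max_right _ _) hD) hq hp hA
  have key : ∀ A B C : ℂ, ‖A - C‖ ≤ ‖A - B‖ + ‖B - C‖ := fun A B C => by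
    calc ‖A - C‖ = ‖(A - B) + (B - C)‖ := by rw [sub_add_sub_cancel]
      _ ≤ ‖A - B‖ + ‖B - C‖ := norm_add_le _ _
  calc _ ≤ _ + _ := key _ (GammaFactor.tau χ * ∑ᶠ x : Chr D,
          χ (x.p : ZMod D) * (((x.p : ℝ) * t0 D : ℝ) : ℂ) ^ (-beta3 c' D) *
            Lemma81.segInt (t0 D) (ell1 D) (-1) (fun s =>
              ktildeSeries c' x s * Bpoly χ x s * omegaW D s)) _
    _ ≤ ε / 2 * frakP D + ε / 2 * frakP D := add_le_add e₁ e₂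
    _ = ε * frakP D := by ring

end Literature.NumberTheory.LFunctions.Zhang2022.Typed.Section15A.U009
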